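import Summits.Schanuel.Schanuel.Theorems.RootDecomp1KCubicDescent02

/-!
# RootDecomp1KCubicDescent — lens 1, generation 59, NODE 20 «3-DESCENT ON THE K-LINE» (Chevalley–Weil through the ℚ-rational 3-torsion μ₃-cover, Runge function w + 2 upstairs; RULE K-R50 (iii) payable clause; CLAIM L2763, PRICE L2766, K-R51) — continuation (RootDecomp1KCubicDescent03): §4 THE ENGINE thinFibreAt_CB (every m₀ ≥ 2, uniform over ℤ⁴)

(lens-1 g59 NODE 20 HOME kernel K = HOME/decomp-schanuel-lens-1/g59/Cubic.lean eea76fbb…, 1125 l, imports tree …RootDecomp1KDescent06 ONLY = the port of node 19 (no Literature import, no fact def, no private, no set_option, no structure, no axiom / instance / sorry / native_decide); Probe / Ctrl0 / Ctrl + NODE-g59.md + SHA256SUMS; CLAIM L2763, writer g30 pre-kernel re-verification L2769, crit g10 EX-ANTE PRICE L2766 (ONE THEOREM ×1 for (A) descent lemma + (B) the uniform theorem thinFibreAt_CB over ℤ⁴ + (C) class/territory CJ j JOINTLY iff CHECKLIST K-g59 (1)–(10); RULE K-R51 pre-announced), census LIVENESS-v12/v13/v14 L2765/L2767/L2771 (node-20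 rows; keys cub3 / frob / tors / jroot; of record L2766/L2768/L2772), NODE L2775, critic VERDICT L2777 (crit g10): CLEARED — THEOREM ×1 for (A) the descent lemma + (B) the uniform theorem thinFibreAt_CB over ℤ⁴ + (C) class/territory CJ j JOINTLY under RULE K-R50 (iii), CHECKLIST K-g59 (1)–(10) met, rung 0; LABEL OF RECORD: literature = VARIANT of a KNOWN TOOL (Chevalley–Weil through a rational-3-torsion μ₃-cover + Runge upstairs: Schaefer 1998 / Levin 2008 Thm 6 made explicit); RULE K-R51 FIXED (toolkit of record ∪= DESCENT IN GENERAL — every further descent-built member / family / torsion order ℓ / engine ×0-as-record; OPEN TERRITORY at m₀ = 2 := K-R49 territory ∧ NO ℚ-rational descent datum, k = 2 certificate = census LIVENESS keys j2rat none ∧ jroot(ℓ) none for ℓ ∈ {2,3,5,7,11} ∧ tors; standing witness W4 certified for ℓ ≤ 11; UNCONDITIONAL PART ∪= CB(ℤ⁴) at ThinFibreAt m₀ ≥ 2); TALLY lens-1 ×17 + THEOREM ×19; PORT GO exactly as census STAGING NOTES 10/10b L2774/L2776 (lens concurred L2775) with the edits (a) + (b) + (c) SANCTIONED. Port by census-1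 gen 23 as `RootDecomp1KCubicDescent01–05` (`--supports stmt-Schanuel-33364`; no census credit): 01 = §0 helpers, §1 the family `CB h₁ h₀ l₁ l₀ = xPolyP 2 (cbC …)` (`cbH`, `cbL`, `cbC`, `bev_CB`), §2 the level equation in integers; 02 = §3 THE DESCENT LEMMA (pure ℤ-arithmetic, six named steps: `dvd_p_of_level`, `dvd_H_of_level`, `even_h_of_level`, `isCoprime_twist`, `eq_cube_of_coprime_cb`, `two_pow_dvd_add_of_cube_cb`; `descent_cb`); 03 = §4 THE ENGINE **`thinFibreAt_CB (h₁ h₀ l₁ l₀ : ℤ) (hm : 2 ≤ m₀) : ThinFibreAt m₀ (CB h₁ h₀ l₁ l₀)`** HYPOTHESIS-FREE, uniform over ℤ⁴ (the Runge function on the μ₃-cover is w + 2); 04 = §5 class data (`xDisc`, `CJ j := CB 0 5 5 (10 + 600 j)`, `cjQ`, `cjD`) and §6 the RABIN certificate mod 3 + Gauss: `Irreducible ((xDisc (CJ j)).map ℚ)` uniformly in j; 05 = §7 TERRITORY (section Territory): `CJ_territory`, named members CJ0 / CJ1. PORT EDITS: (a) 33 one-line docstrings quoting the signature on the undocumented decls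 (`cbC_two` / `cbC_one` / `cbC_zero` / `cbC_of_gt`, `aeval_cbH`, `aeval_cbL`, `monic_cbH`, `cbH_ne_zero`, `natDegree_cjD`, `coeff_cjD_six/five/four`, `leadingCoeff_cjD`, `ra2` … `re3`, `natDegree_cbH`, `natDegree_cbC_zero`, `natDegree_cbC_one_055`, `coeff_zero_cbC_two_055`, `monic_cjQ`, `natDegree_cjQ`, `cjQ_ne_zero`, `coeff_four_cjQ`, `cbC_two_055_ne_zero`, `bzB`, `bzM`, `bzW`, `thinFibreAt_two_CJ1`, `CJ0_territory`); (b) PRIVATISATION ×2 of the §0 one-liners that the head dry-run BOUNCED as dedup.landed twins of importable out-of-cone declarations — `isCoprime_num_den_cb` (≡ `Literature.NumberTheory.DiophantineApproximation.isCoprime_num_den`) and `odd_psNumer_cb` (≡ `RootDecomp1KCollarCell.odd_psNumer_two`, CollarCell02 = +53 modules) — with file-local private copies in 03 where §4's `thinFibreAt_CB` uses them; (c) K's import line moved ABOVE its 4-line copyright comment (the part-01 provenance module docstring must follow the import; comment kept verbatim); nothing else (no deletion, no replacement of a statement, no import added, no set_option; K's `@[simp]` kept); provenance doc blocks + continuation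 headers = K's own open-lines; statements and proofs VERBATIM. Rung 0 — nothing here proves Schanuel, 33364, 33363, 31077 or ThinFibre 2; everything HYPOTHESIS-FREE.)
-/

noncomputable section

namespace Summit.Schanuel.Schanuel.Theorems.RootDecomp1KCubicDescent

open Polynomial LiouvilleNumber
open scoped Nat
open Summit.Schanuel.Schanuel.Theorems.RootDecomp1KTwoBaseCell (psNumer partialSum_eq_psNumer_div coprime_psNumer)
open Summit.Schanuel.Schanuel.Theorems.RootDecomp1KDegreeLadder
open Summit.Schanuel.Schanuel.Theorems.RootDecomp1KXLinear
open Summit.Schanuel.Schanuel.Theorems.RootDecomp1KXLinearII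
open Summit.Schanuel.Schanuel.Theorems.RootDecomp1KXTop
open Summit.Schanuel.Schanuel.Theorems.RootDecomp1KXAll
open Summit.Schanuel.Schanuel.Theorems.RootDecomp1KLevelFinite
open Summit.Schanuel.Schanuel.Theorems.RootDecomp1KThueMahler
open Summit.Schanuel.Schanuel.Theorems.RootDecomp1KParamThueMahler
open Summit.Schanuel.Schanuel.Theorems.RootDecomp1KLocalExponent
open Summit.Schanuel.Schanuel.Theorems.RootDecomp1KIntegrality (GaussAt gaussAt_xPolyP_iff)
open Summit.Schanuel.Schanuel.Theorems.RootDecomp1KSubspaceBranch (SepTopAt)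
open Summit.Schanuel.Schanuel.Theorems.RootDecomp1KRunge
open Summit.Schanuel.Schanuel.Theorems.RootDecomp1KDescent

/-- `num r ⊥ den r`. -/
private theorem isCoprime_num_den_cb (r : ℚ) : IsCoprime r.num (r.den : ℤ) := by
  rw [Int.isCoprime_iff_gcd_eq_one]
  have := r.reduced
  simpa [Int.gcd] using this

/-- `p_N` is odd (`N ≥ 2`). -/
private theorem odd_psNumer_cb {N : ℕ} (hN : 2 ≤ N) : Odd ((psNumer 2 N : ℕ) : ℤ) := by
  have h := coprime_psNumer 2 hN
  have h2 : ¬ 2 ∣ psNumer 2 N := by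
    intro hd
    have := Nat.Coprime.eq_one_of_dvd (Nat.Coprime.symm h) hd
    omega
  rw [Int.odd_iff]
  omega

/-! ### §4 THE ENGINE: `ThinFibreAt m₀ (CB h₁ h₀ l₁ l₀)` for every `m₀ ≥ 2`, hypothesis-free -/

/-- `(h₁ h₀ : ℤ) : (cbH h₁ h₀).Monic`. -/
theorem monic_cbH (h₁ h₀ : ℤ) : (cbH h₁ h₀).Monic := by unfold cbH; monicity!

/-- `(h₁ h₀ : ℤ) : cbH h₁ h₀ ≠ 0`. -/
theorem cbH_ne_zero (h₁ h₀ : ℤ) : cbH h₁ h₀ ≠ 0 := (monic_cbH h₁ h₀).ne_zero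

/-- `N! = (N! − 3) + 3` for `N ≥ 3`. -/
theorem factorial_split_cb {N : ℕ} (hN : 3 ≤ N) : N ! = ((N !) - 3) + 3 := by
  have := Nat.self_le_factorial N
  omega

/-- the archimedean half: from `4p·e³ = q·d·H̃ − 4p·d³` (reals: `e³ = d³·(H(r)/(4 s_N) − 1)`), `s_N ≥ 1/2`
and `|H(r)| ≤ M`: `|e| ≤ d·(M/2 + 1)`. -/
theorem abs_e_le_cb {p q d e Ht Hr M : ℝ} (hp : 0 < p) (hq : 0 < q) (hd : 0 < d) (hs : 1 / 2 ≤ p / q)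
    (hHt : Ht = d ^ 2 * Hr) (hM : |Hr| ≤ M) (hM0 : 0 ≤ M)
    (hid : 4 * p * e ^ 3 = q * d * Ht - 4 * p * d ^ 3) : |e| ≤ d * (M / 2 + 1) := by
  set B : ℝ := M / 2 + 1 with hB
  have hB1 : 1 ≤ B := by rw [hB]; linarith
  -- e³ = d³·(q·Hr/(4p) − 1)
  have he3 : e ^ 3 = d ^ 3 * (q * Hr / (4 * p) - 1) := by
    have hp0 : p ≠ 0 := hp.ne'
    field_simp
    rw [hHt] at hid
    linear_combination hid
  -- |q·Hr/(4p) − 1| ≤ M/2 + 1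
  have hq4p : q / (4 * p) ≤ 1 / 2 := by
    rw [div_le_iff₀ (by positivity)]
    rw [le_div_iff₀ hq] at hs
    linarith
  have hq4p0 : 0 ≤ q / (4 * p) := by positivity
  have hfac : |q * Hr / (4 * p) - 1| ≤ B := by
    have e1 : q * Hr / (4 * p) = q / (4 * p) * Hr := by ring
    rw [e1]
    calc |q / (4 * p) * Hr - 1| ≤ |q / (4 * p) * Hr| + |(1 : ℝ)| := abs_sub _ _
      _ = q / (4 * p) * |Hr| + 1 := by rw [abs_mul, abs_of_nonneg hq4p0, abs_one]
      _ ≤ 1 / 2 * M + 1 := by gcongr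
      _ = B := by rw [hB]; ring
  -- |e|³ ≤ (d·B)³
  have h3 : |e| ^ 3 ≤ (d * B) ^ 3 := by
    have : |e| ^ 3 = d ^ 3 * |q * Hr / (4 * p) - 1| := by
      rw [← abs_pow, he3, abs_mul, abs_of_nonneg (by positivity : (0 : ℝ) ≤ d ^ 3)]
    rw [this, mul_pow]
    have hB3 : |q * Hr / (4 * p) - 1| ≤ B ^ 3 := by
      calc |q * Hr / (4 * p) - 1| ≤ B := hfac
        _ = B ^ 1 := (pow_one B).symm
        _ ≤ B ^ 3 := pow_le_pow_right₀ hB1 (by norm_num)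
    exact mul_le_mul_of_nonneg_left hB3 (by positivity)
  by_contra hlt
  have hlt' : d * B < |e| := not_le.mp hlt
  have : (d * B) ^ 3 < |e| ^ 3 := pow_lt_pow_left₀ hlt' (by positivity) (by norm_num)
  linarith

/-- THE ROOT BRANCH, named: `e + d = 0` forces `H̃ = 0` (from `4pe³ = q·d·H̃ − 4pd³`, `q·d ≠ 0`) — so `H(r) = 0`,
`r` is one of the `≤ 2` rational roots of `H`, each on finitely many levels (tree `levels_finite_of_nondeg`, the ONLY
use of the clause's non-degeneracy proviso). -/
theorem Ht_eq_zero_of_root_branch_cb {p q d e Ht : ℤ} (hq : q ≠ 0) (hd : d ≠ 0)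
    (hid : 4 * p * e ^ 3 = q * d * Ht - 4 * p * d ^ 3) (hed : e + d = 0) : Ht = 0 := by
  have he : e = -d := by linarith
  rw [he] at hid
  have h : q * d * Ht = 0 := by linear_combination hid.symm
  rcases mul_eq_zero.mp h with h0 | h0
  · exact absurd h0 (mul_ne_zero hq hd)
  · exact h0

/-- THE RUNGE BRANCH, named: `e + d ≠ 0` and `2^{k+2} ∣ e + d` give `2^{k+2} ≤ |e + d|` (the product formula for
the non-zero integer `w + 2 = e + d`: 2-adically tiny, hence archimedeanly large). -/
theorem two_pow_le_abs_of_runge_branch_cb {e d : ℤ} {k : ℕ} (hdiv : (2 : ℤ) ^ (k + 2) ∣ e + d) (hed : e + d ≠ 0) :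
    (2 : ℤ) ^ (k + 2) ≤ |e + d| :=
  Int.le_of_dvd (abs_pos.mpr hed) ((dvd_abs _ _).mpr hdiv)

/-- **THE ENGINE (NODE 20).**  For ALL integers `h₁ h₀ l₁ l₀` and every `m₀ ≥ 2`, the K-line clause
`ThinFibreAt m₀` holds for `CB(h₁,h₀,l₁,l₀) = (H²+4L)·x² + (4 − L·H)·x − H` — hypothesis-free, no
certificate data.  At a level point `(s_N, r)` with `N ≥ N₀(C)`: the descent lemma gives `e ∈ ℤ` with
`2^{N!−1} ∣ e + den r`; either `e + den r = 0`, forcing `H(r) = 0` (finitely many `r`, each on finitely many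
levels by the clause's non-degeneracy proviso and the tree's `levels_finite_of_nondeg`), or
`2^{N!−1} ≤ |e + den r| ≤ (B(C) + 1)·den r`, and the tree's `runge_arith` (`b = 1`, `M − a = 1`) ends it. -/
theorem thinFibreAt_CB (h₁ h₀ l₁ l₀ : ℤ) {m₀ : ℕ} (hm : 2 ≤ m₀) : ThinFibreAt m₀ (CB h₁ h₀ l₁ l₀) := by
  classical
  intro C
  obtain ⟨M, hM0, hM⟩ := exists_abs_aeval_le (cbH h₁ h₀) C
  obtain ⟨N₂, hN₂⟩ := runge_arith (2 * (M / 2 + 1 + 1)) C 1 m₀ 1 0 (by omega)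
  -- the root levels: `H(r) = 0`, `r` non-degenerate
  set R : Set ℚ := {r : ℚ | aeval r (cbH h₁ h₀) = 0 ∧ ∃ x : ℝ, bev (CB h₁ h₀ l₁ l₀) x r ≠ 0} with hR
  have hRfin : R.Finite := (roots_finite_ds _ (cbH_ne_zero h₁ h₀)).subset fun r hr => hr.1
  have hU : (⋃ r ∈ R, {N : ℕ | bev (CB h₁ h₀ l₁ l₀) (partialSum 2 N) r = 0}).Finite :=
    hRfin.biUnion fun r hr => levels_finite_of_nondeg _ r hr.2
  obtain ⟨N₃, hN₃⟩ := hU.bddAbove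
  refine ⟨max (max N₂ 3) (N₃ + 1), fun N hN r hrC hP hnd => ?_⟩
  have hNN₂ : N₂ ≤ N := le_trans (le_trans (le_max_left _ _) (le_max_left _ _)) hN
  have hN3 : 3 ≤ N := le_trans (le_trans (le_max_right _ _) (le_max_left _ _)) hN
  have hNN₃ : N₃ + 1 ≤ N := le_trans (le_max_right _ _) hN
  -- integers
  set p : ℤ := ((psNumer 2 N : ℕ) : ℤ) with hp
  set u : ℤ := r.num with hu
  set d : ℤ := (r.den : ℤ) with hd
  have hp0 : 0 < p := by rw [hp]; exact_mod_cast psNumer_pos_runge N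
  have hpodd : Odd p := by rw [hp]; exact odd_psNumer_cb (by omega)
  have hd0 : 0 < d := by rw [hd]; exact_mod_cast r.den_pos
  have hud : IsCoprime u d := isCoprime_num_den_cb r
  obtain ⟨k, hk⟩ : ∃ k, N ! = k + 3 := ⟨(N !) - 3, factorial_split_cb hN3⟩
  have hq : (2 : ℤ) ^ N ! = 8 * 2 ^ k := by rw [hk, pow_add]; ring
  -- the level equation, in the descent lemma's shape
  have hlev := level_eq_cb hP
  rw [hq] at hlev
  have hlev' : p ^ 2 * ((u ^ 2 + d * (h₁ * u + h₀ * d)) ^ 2 + 4 * d ^ 3 * (l₁ * u + l₀ * d)) +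
      p * (8 * 2 ^ k) * d * (4 * d ^ 3 - (l₁ * u + l₀ * d) * (u ^ 2 + d * (h₁ * u + h₀ * d))) -
      (8 * 2 ^ k) ^ 2 * d ^ 2 * (u ^ 2 + d * (h₁ * u + h₀ * d)) = 0 := by
    rw [hp, hu, hd]; linear_combination hlev
  -- THE DESCENT
  obtain ⟨e, hdiv, hid⟩ := descent_cb hpodd hp0 hd0 hud hlev'
  -- real-number bookkeeping: u = r·d, H̃ = d²·H(r), s_N = p/q
  have hur : ((u : ℝ)) = (r : ℝ) * (d : ℝ) := by
    rw [hu, hd]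
    have h1 : ((r.num : ℚ) : ℝ) = (((r * r.den : ℚ)) : ℝ) := by rw [Rat.mul_den_eq_num]
    push_cast at h1 ⊢
    exact h1
  have hHt : (((u ^ 2 + d * (h₁ * u + h₀ * d) : ℤ)) : ℝ) = (d : ℝ) ^ 2 * aeval (r : ℝ) (cbH h₁ h₀) := by
    rw [aeval_cbH]; push_cast; rw [hur]; ring
  by_cases hed : e + d = 0
  · -- the root branch: H(r) = 0, so (r, N) is one of finitely many root levels — excluded by N > N₃
    exfalso
    have hHt0 : u ^ 2 + d * (h₁ * u + h₀ * d) = 0 :=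
      Ht_eq_zero_of_root_branch_cb (q := 8 * 2 ^ k) (by positivity) hd0.ne' hid hed
    have hHr : aeval (r : ℝ) (cbH h₁ h₀) = 0 := by
      have hd2 : (d : ℝ) ^ 2 ≠ 0 := pow_ne_zero _ (by exact_mod_cast hd0.ne')
      have := hHt
      rw [hHt0] at this
      push_cast at this
      rcases mul_eq_zero.mp this.symm with h0 | h0
      · exact absurd h0 hd2
      · exact h0
    have hHrQ : aeval r (cbH h₁ h₀) = 0 := by
      have : ((aeval r (cbH h₁ h₀) : ℚ) : ℝ) = 0 := by
        rw [← hHr, aeval_cbH, aeval_cbH]; push_cast; ring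
      exact_mod_cast this
    have hrR : r ∈ R := ⟨hHrQ, hnd⟩
    have hNmem : N ∈ ⋃ r ∈ R, {N : ℕ | bev (CB h₁ h₀ l₁ l₀) (partialSum 2 N) r = 0} :=
      Set.mem_biUnion hrR hP
    have := hN₃ hNmem
    omega
  · -- the Runge branch: 2^{N!-1} ≤ |e + d| ≤ (B+1)·d
    have hlow : (2 : ℤ) ^ (k + 2) ≤ |e + d| := two_pow_le_abs_of_runge_branch_cb hdiv hed
    -- the archimedean bound
    have hs : (1 : ℝ) / 2 ≤ (p : ℝ) / ((8 * 2 ^ k : ℤ) : ℝ) := by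
      have := half_le_partialSum_cb N
      rw [partialSum_two_eq_ratCast] at this
      rw [hp]; push_cast at this ⊢
      have e8 : (8 * 2 ^ k : ℝ) = 2 ^ N ! := by rw [hk, pow_add]; ring
      rw [e8]; exact this
    have habs := abs_e_le_cb (p := (p : ℝ)) (q := ((8 * 2 ^ k : ℤ) : ℝ)) (d := (d : ℝ)) (e := (e : ℝ))
      (Ht := (((u ^ 2 + d * (h₁ * u + h₀ * d) : ℤ)) : ℝ)) (Hr := aeval (r : ℝ) (cbH h₁ h₀)) (M := M)
      (by exact_mod_cast hp0) (by push_cast; positivity) (by exact_mod_cast hd0) hs hHt (hM r hrC) hM0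
      (by exact_mod_cast hid)
    -- combine: 2^{k+3} ≤ 2·|e + d| ≤ 2(|e| + d) ≤ 2·(M/2+2)·d
    have hineq : (2 : ℝ) ^ ((1 - 0) * N !) ≤ 2 * (M / 2 + 1 + 1) * ((r.den : ℕ) : ℝ) ^ 1 := by
      have h1 : ((2 : ℤ) ^ (k + 2) : ℝ) ≤ |(e : ℝ) + (d : ℝ)| := by
        have := hlow
        have h' : (((2 : ℤ) ^ (k + 2) : ℤ) : ℝ) ≤ ((|e + d| : ℤ) : ℝ) := by exact_mod_cast this
        push_cast at h'
        exact h'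
      have h2 : |(e : ℝ) + (d : ℝ)| ≤ |(e : ℝ)| + (d : ℝ) := by
        calc |(e : ℝ) + (d : ℝ)| ≤ |(e : ℝ)| + |(d : ℝ)| := abs_add_le _ _
          _ = |(e : ℝ)| + (d : ℝ) := by rw [abs_of_pos (show (0 : ℝ) < (d : ℝ) by exact_mod_cast hd0)]
      have hdR : ((r.den : ℕ) : ℝ) = (d : ℝ) := by rw [hd]; push_cast; rfl
      rw [show (1 - 0) * N ! = (k + 2) + 1 by omega, pow_succ, pow_one, hdR]
      push_cast at h1
      nlinarith [h1, h2, habs, hd0]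
    exact hN₂ N hNN₂ r.den r.den_pos hineq

/-- EVERY rational fibre of EVERY `CB` is non-degenerate (if `H(r) ≠ 0` take `x = 0`; else `c₁(r) = 4` and
`CB(±1, r) = 4L(r) ± 4` are not both zero) — so the clause's non-degeneracy proviso is AUTOMATIC for the family:
`thinFibreAt_CB` is about ALL level points of bounded height. -/
theorem CB_nondeg (h₁ h₀ l₁ l₀ : ℤ) (r : ℚ) : ∃ x : ℝ, bev (CB h₁ h₀ l₁ l₀) x r ≠ 0 := by
  by_cases hH : ((r : ℝ) ^ 2 + h₁ * r + h₀ : ℝ) = 0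
  · by_cases h1 : bev (CB h₁ h₀ l₁ l₀) 1 r = 0
    · refine ⟨-1, fun h2 => ?_⟩
      rw [bev_CB, hH] at h1 h2
      have : (8 : ℝ) = 0 := by linear_combination h1 - h2
      norm_num at this
    · exact ⟨1, h1⟩
  · exact ⟨0, fun h0 => hH (by rw [bev_CB] at h0; linear_combination -h0)⟩

/-- **COROLLARY: the clause WITHOUT proviso** for the family. -/
theorem thinFibreAt_CB' (h₁ h₀ l₁ l₀ : ℤ) {m₀ : ℕ} (hm : 2 ≤ m₀) (C : ℝ) :
    ∃ N₀ : ℕ, ∀ N : ℕ, N₀ ≤ N → ∀ r : ℚ, |(r : ℝ)| ≤ C →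
      bev (CB h₁ h₀ l₁ l₀) (partialSum 2 N) r = 0 → C * 2 ^ (N + 1)! < (r.den : ℝ) ^ (m₀ * N) := by
  obtain ⟨N₀, hN₀⟩ := thinFibreAt_CB h₁ h₀ l₁ l₀ hm C
  exact ⟨N₀, fun N hN r hrC hP => hN₀ N hN r hrC hP (CB_nondeg h₁ h₀ l₁ l₀ r)⟩

end Summit.Schanuel.Schanuel.Theorems.RootDecomp1KCubicDescent

end
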